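import Summits.BirchSwinnertonDyer.Rank1Residual.Iwasawa.UnitCoefficientCertificate
import Literature.NumberTheory.EllipticCurves.PAdicLFunctionSplitRiemannSumCertificateProofs
import HarnessLib

/-!
# The unit-coefficient certificate from ONE certified Riemann sum (cell `b2b-bsdres`, instrument
# unit `b2b-bsdres-iw-1` — IWASAWA-INVARIANT CENSUS Part I, gen 14; kernel companion of
# HOME/IWASAWA-CENSUS.md §4.4 / §4.6 and of the census certificates `certs/iw/<label>@<p>.json`
# at a MULTIPLICATIVE prime)

HONEST FRAMING (run/shared/lean/b2b/bsd-rank1-residual/, verbatim in every file): prove what is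
provable now; shrink each hard class to its core with data; no claim beyond stated classes.
Theorems only, plus ONE `Prop`-valued certificate shape (`RiemannSumUnitCertAt`; nothing asserted);
no named fact is introduced; nothing about any particular curve is asserted; nothing is booked.

## What this file proves

cc-typer-6's Riemann-sum certificate theorems (`PAdicLFunctionNonsplitRiemannSumCertificateProofs`,
`PAdicLFunctionSplitRiemannSumCertificateProofs`: for THE Mazur–Tate–Teitelbaum function at a
multiplicative prime, `(C/‖k!‖_p)·p⁻ⁿ < ‖RS k n‖ ⟹ ‖[T^k]L‖ = ‖RS k n‖`, with `RS` the exact finite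
Riemann sums of the (signed) plus-symbol measure and `C` any plus-symbol bound) are composed with the
census's certificate SHAPE `UnitCoeffAt W p n` (`Iwasawa/UnitCoefficientCertificate.lean` §2: the
coefficient of index `n + e` of the Néron-normalised series `ϖ·L_p` is a `p`-adic unit, for every
newform `f` of `W` and every `ϖ` with `ϖ·Ω_E = Ω⁺_f`).  The input is the per-pair DATUM the census
engines compute, typed as `RiemannSumUnitCertAt W p n`: for every such `f, ϖ`, a plus-symbol bound
`C`, a level `n₀` and the exact Riemann sums `RS` with the truncation inequality at index `k = n + e`
AND `‖ϖ · RS k n₀‖_p = 1`.  Output: `UnitCoeffAt W p n` (`unitCoeffAt_of_riemannSumUnitCertAt`), hence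
everything downstream of it in `Iwasawa/UnitCoefficientCertificateMultiplicative.lean` (squeeze,
minimal pairs, Schneider ∧ `Ш[p^∞]` finite) takes a Riemann-sum certificate as its numerical input.
The `∀`-newform quantifier is kept on both sides (the datum is stated per newform, exactly as
`UnitCoeffAt` is), so no multiplicity-one input is needed here.

References: [MazurTateTeitelbaum1986Invent] §I.10–I.15; [SteinWuthrich2013] §3, §4.2 and §11 remark
(p. 29); [GreenbergVatsal2000] p. 2–4; HOME/IWASAWA-CENSUS.md §4.4, §4.6, §21.
-/

noncomputable section

open scoped Classical MatrixGroups ModularForm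

open CongruenceSubgroup WeierstrassCurve Literature.NumberTheory.EllipticCurves
  Literature.NumberTheory.EllipticCurves.ModularForms

set_option autoImplicit false

namespace Summit.BirchSwinnertonDyer.Rank1Residual.Iwasawa

section Shapes

variable (W : WeierstrassCurve ℚ) [W.IsElliptic] [W.IsGloballyMinimal] (p : ℕ) [Fact p.Prime]

/-- **The Riemann-sum unit certificate at index `n`** (a `Prop`; nothing asserted — the datum of a
census certificate at a multiplicative prime, in the currency of cc-typer-6's certificate theorems):
for every newform `f` of `W` and every `ϖ ∈ ℚ` with `ϖ·Ω_E = Ω⁺_f` there are a plus-symbol bound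
`C` (`‖[a/p^m]⁺_f‖_p ≤ C` for all `m, a`), a level `n₀` and the exact Riemann sums `RS` of the
plus-symbol measure (signed by `(−1)^m` at a non-split `p`) such that, at `k = n` (non-split), resp.
`k = n + 1` (split: the trivial zero), the truncation error `(C/‖k!‖_p)·p^{−n₀}` is `< ‖RS k n₀‖`
and `‖ϖ · RS k n₀‖_p = 1`. [cite: SteinWuthrich2013, §3 and §4.2 (shape only; nothing asserted)]
[cite: MazurTateTeitelbaum1986Invent, §I.10 Prop. and §I.14 (shape only; nothing asserted)] -/
def RiemannSumUnitCertAt (n : ℕ) : Prop :=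
  ∀ {N : ℕ} [NeZero N] (f : CuspForm (Gamma0 N) 2), IsNewformOf W f →
    ∀ (ϖ : ℚ), (ϖ : ℝ) * W.realPeriodRat = plusPeriod f →
      (¬ W.HasSplitMultiplicativeReductionAtPrime p →
        ∃ (C : ℝ) (n₀ : ℕ) (RS : ℕ → ℕ → ℚ_[p]),
          (∀ k m : ℕ, RS k m =
            ∑ᶠ ξ : rootsOfUnity (torsionOrder p) ℤ_[p], ∑ s : ZMod (p ^ m),
              (fun (m : ℕ) (a : ZMod (p ^ m)) ↦
                  (-1 : ℚ_[p]) ^ m * (ratPlusSymbol f ((a.val : ℚ) / (p : ℚ) ^ m) : ℚ_[p]))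
                (m + cyclotomicExponent p)
                  (PadicInt.toZModPow (m + cyclotomicExponent p) ((ξ : ℤ_[p]ˣ) : ℤ_[p]) *
                    (cyclotomicGenerator p : ZMod (p ^ (m + cyclotomicExponent p))) ^ s.val) *
                ((s.val.choose k : ℕ) : ℚ_[p])) ∧
          (∀ (m : ℕ) (a : ZMod (p ^ m)),
            ‖(ratPlusSymbol f ((a.val : ℚ) / (p : ℚ) ^ m) : ℚ_[p])‖ ≤ C) ∧
          C / ‖((n.factorial : ℕ) : ℚ_[p])‖ * (p : ℝ) ^ (-n₀ : ℤ) < ‖RS n n₀‖ ∧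
          ‖((ϖ : ℚ) : ℚ_[p]) * RS n n₀‖ = 1) ∧
      (W.HasSplitMultiplicativeReductionAtPrime p →
        ∃ (C : ℝ) (n₀ : ℕ) (RS : ℕ → ℕ → ℚ_[p]),
          (∀ k m : ℕ, RS k m =
            ∑ᶠ ξ : rootsOfUnity (torsionOrder p) ℤ_[p], ∑ s : ZMod (p ^ m),
              (fun (m : ℕ) (a : ZMod (p ^ m)) ↦
                  (ratPlusSymbol f ((a.val : ℚ) / (p : ℚ) ^ m) : ℚ_[p]))
                (m + cyclotomicExponent p)
                  (PadicInt.toZModPow (m + cyclotomicExponent p) ((ξ : ℤ_[p]ˣ) : ℤ_[p]) *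
                    (cyclotomicGenerator p : ZMod (p ^ (m + cyclotomicExponent p))) ^ s.val) *
                ((s.val.choose k : ℕ) : ℚ_[p])) ∧
          (∀ (m : ℕ) (a : ZMod (p ^ m)),
            ‖(ratPlusSymbol f ((a.val : ℚ) / (p : ℚ) ^ m) : ℚ_[p])‖ ≤ C) ∧
          C / ‖(((n + 1).factorial : ℕ) : ℚ_[p])‖ * (p : ℝ) ^ (-n₀ : ℤ) < ‖RS (n + 1) n₀‖ ∧
          ‖((ϖ : ℚ) : ℚ_[p]) * RS (n + 1) n₀‖ = 1)

end Shapes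

section Composition

variable {W : WeierstrassCurve ℚ} {p : ℕ} [Fact p.Prime]

/-- Norm bookkeeping: `‖[T^k](ϖ·L)‖ = ‖ϖ‖·‖[T^k]L‖`, so `‖[T^k]L‖ = ‖R‖` and `‖ϖ·R‖ = 1` give
`‖[T^k](ϖ·L)‖ = 1`. [folklore] -/
theorem norm_coeff_C_mul_eq_one_of_norm_eq {k : ℕ} {L : PowerSeries ℚ_[p]} {c R : ℚ_[p]}
    (hcoeff : ‖PowerSeries.coeff k L‖ = ‖R‖) (hunit : ‖c * R‖ = 1) :
    ‖PowerSeries.coeff k (PowerSeries.C c * L)‖ = 1 := by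
  rw [PowerSeries.coeff_C_mul, norm_mul, hcoeff, ← norm_mul, hunit]

/-- **Non-split branch**: at a non-split multiplicative `p`, ONE certified Riemann sum of the signed
measure at index `n` with `‖ϖ·RS n n₀‖ = 1` gives `‖[T^n](ϖ·L)‖ = 1` for THE non-split function
(every `L` with `IsMultPAdicLFunctionOf f p (-1) L`). [cite: SteinWuthrich2013, §3 and §4.2]
[cite: MazurTateTeitelbaum1986Invent, §I.10 Prop. and §I.14 (14.3)] -/
theorem norm_coeff_eq_one_of_riemannSum_nonsplit {N : ℕ} [NeZero N] {f : CuspForm (Gamma0 N) 2}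
    (hf : IsNewformOf W f) (hmult : W.HasMultiplicativeReductionAtPrime p)
    (hns : ¬ W.HasSplitMultiplicativeReductionAtPrime p) {RS : ℕ → ℕ → ℚ_[p]}
    (hRS : ∀ k m : ℕ, RS k m =
      ∑ᶠ ξ : rootsOfUnity (torsionOrder p) ℤ_[p], ∑ s : ZMod (p ^ m),
        (fun (m : ℕ) (a : ZMod (p ^ m)) ↦
            (-1 : ℚ_[p]) ^ m * (ratPlusSymbol f ((a.val : ℚ) / (p : ℚ) ^ m) : ℚ_[p]))
          (m + cyclotomicExponent p)
            (PadicInt.toZModPow (m + cyclotomicExponent p) ((ξ : ℤ_[p]ˣ) : ℤ_[p]) *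
              (cyclotomicGenerator p : ZMod (p ^ (m + cyclotomicExponent p))) ^ s.val) *
          ((s.val.choose k : ℕ) : ℚ_[p]))
    {C : ℝ} (hC : ∀ (m : ℕ) (a : ZMod (p ^ m)),
      ‖(ratPlusSymbol f ((a.val : ℚ) / (p : ℚ) ^ m) : ℚ_[p])‖ ≤ C)
    {k n₀ : ℕ} (hlt : C / ‖((k.factorial : ℕ) : ℚ_[p])‖ * (p : ℝ) ^ (-n₀ : ℤ) < ‖RS k n₀‖)
    {ϖ : ℚ_[p]} (hunit : ‖ϖ * RS k n₀‖ = 1)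
    {L : PowerSeries ℚ_[p]} (hL : IsMultPAdicLFunctionOf f p (-1) L) :
    ‖PowerSeries.coeff k (PowerSeries.C ϖ * L)‖ = 1 :=
  norm_coeff_C_mul_eq_one_of_norm_eq
    (hL.norm_coeff_eq_of_nonsplit_of_lt hRS hf hmult hns hC hlt).1 hunit

/-- **Split branch**: at a split multiplicative `p`, ONE certified Riemann sum of the plus-symbol
measure at index `k` with `‖ϖ·RS k n₀‖ = 1` gives `‖[T^k](ϖ·L)‖ = 1` for THE split function (every
`L` with `IsSplitMultPAdicLFunctionOf f p L`; uniqueness bsd.S23). [cite: SteinWuthrich2013, §3 and §4.2]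
[cite: MazurTateTeitelbaum1986Invent, §I.10 Prop. and §I.14 (14.3), §I.15] -/
theorem norm_coeff_eq_one_of_riemannSum_split {N : ℕ} [NeZero N] {f : CuspForm (Gamma0 N) 2}
    (hf : IsNewformOf W f) (hsplit : W.HasSplitMultiplicativeReductionAtPrime p)
    {RS : ℕ → ℕ → ℚ_[p]}
    (hRS : ∀ k m : ℕ, RS k m =
      ∑ᶠ ξ : rootsOfUnity (torsionOrder p) ℤ_[p], ∑ s : ZMod (p ^ m),
        (fun (m : ℕ) (a : ZMod (p ^ m)) ↦ (ratPlusSymbol f ((a.val : ℚ) / (p : ℚ) ^ m) : ℚ_[p]))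
          (m + cyclotomicExponent p)
            (PadicInt.toZModPow (m + cyclotomicExponent p) ((ξ : ℤ_[p]ˣ) : ℤ_[p]) *
              (cyclotomicGenerator p : ZMod (p ^ (m + cyclotomicExponent p))) ^ s.val) *
          ((s.val.choose k : ℕ) : ℚ_[p]))
    {C : ℝ} (hC : ∀ (m : ℕ) (a : ZMod (p ^ m)),
      ‖(ratPlusSymbol f ((a.val : ℚ) / (p : ℚ) ^ m) : ℚ_[p])‖ ≤ C)
    {k n₀ : ℕ} (hlt : C / ‖((k.factorial : ℕ) : ℚ_[p])‖ * (p : ℝ) ^ (-n₀ : ℤ) < ‖RS k n₀‖)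
    {ϖ : ℚ_[p]} (hunit : ‖ϖ * RS k n₀‖ = 1)
    {L : PowerSeries ℚ_[p]} (hL : IsSplitMultPAdicLFunctionOf f p L) :
    ‖PowerSeries.coeff k (PowerSeries.C ϖ * L)‖ = 1 :=
  norm_coeff_C_mul_eq_one_of_norm_eq
    (hL.norm_coeff_eq_of_split_of_lt hRS hsplit hf hC hlt).1 hunit

/-- **The unit-coefficient certificate from a Riemann-sum certificate**: at a multiplicative prime,
`RiemannSumUnitCertAt W p n ⟹ UnitCoeffAt W p n` — so the squeeze / minimal-pair / Schneider ∧ `Ш`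
compositions of `Iwasawa/UnitCoefficientCertificateMultiplicative.lean` take, as their numerical
input, one certified Riemann sum per newform and period scaling (the census engines' datum) instead
of a statement about THE `p`-adic `L`-function. [cite: SteinWuthrich2013, §3, §4.2 and §11 remark (p. 29)]
[cite: GreenbergVatsal2000, p. 2–3, (1)–(2)] -/
theorem unitCoeffAt_of_riemannSumUnitCertAt (hmult : W.HasMultiplicativeReductionAtPrime p) {n : ℕ}
    (h : RiemannSumUnitCertAt W p n) : UnitCoeffAt W p n := by
  intro N _ f hf ϖ hϖ
  obtain ⟨hns, hs⟩ := h f hf ϖ hϖ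
  refine ⟨fun h' L hL => ?_, fun h' L hL => ?_⟩
  · obtain ⟨C, n₀, RS, hRS, hC, hlt, hunit⟩ := hns h'
    exact norm_coeff_eq_one_of_riemannSum_nonsplit hf hmult h' hRS hC hlt hunit hL
  · obtain ⟨C, n₀, RS, hRS, hC, hlt, hunit⟩ := hs h'
    exact norm_coeff_eq_one_of_riemannSum_split hf h' hRS hC hlt hunit hL

/-- `RiemannSumUnitCertAt` refines x11a's `μ_an(E,p) = 0` certificate (via `UnitCoeffAt`). [folklore] -/
theorem muAnZeroAt_of_riemannSumUnitCertAt [W.IsElliptic] [W.IsGloballyMinimal]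
    (hmult : W.HasMultiplicativeReductionAtPrime p) {n : ℕ}
    (h : RiemannSumUnitCertAt W p n) : X11a.MuAnZeroAt W p :=
  muAnZeroAt_of_unitCoeffAt (unitCoeffAt_of_riemannSumUnitCertAt hmult h)

end Composition

end Summit.BirchSwinnertonDyer.Rank1Residual.Iwasawa

end
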